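import Summits.CriticalPhenomena.Ising3DConformalLimit.Theorems.EnergyNotSigmaSquaredMoebiusLimitExistsPedigreeAssembly
import Summits.CriticalPhenomena.Ising3DConformalLimit.Theorems.EnergyNotSigmaSquaredMoebiusLimitExistsDoubledThickening
import Summits.CriticalPhenomena.Ising3DConformalLimit.Theorems.EnergyNotSigmaSquaredMoebiusLimitExistsCompactnessSchema
import Summits.CriticalPhenomena.Ising3DConformalLimit.Theorems.EnergyNotSigmaSquaredMoebiusLimitExistsLocallyBounded
import Summits.CriticalPhenomena.Ising3DConformalLimit.Theorems.EnergyNotSigmaSquaredMoebiusLimitExistsTranslationInvariant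
import Summits.CriticalPhenomena.Ising3DConformalLimit.Theorems.EnergyNotSigmaSquaredMoebiusLimitExistsEquicontinuousTwo
import Summits.CriticalPhenomena.Ising3DConformalLimit.Theorems.EnergyNotSigmaSquaredMoebiusLimitExistsTelescoping
import Summits.CriticalPhenomena.Ising3DConformalLimit.Theorems.EnergyNotSigmaSquaredMoebiusLimitExistsPedigreeMono
import Summits.CriticalPhenomena.Ising3DConformalLimit.Theorems.EnergyNotSigmaSquaredMoebiusLimitExistsPedigreeCovering
import Summits.CriticalPhenomena.Ising3DConformalLimit.Theorems.EnergyNotSigmaSquaredMoebiusLimitExistsPedigreeCover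
import Summits.CriticalPhenomena.Ising3DConformalLimit.Theorems.EnergyNotSigmaSquaredMoebiusLimitExistsSVEquicontTransport
import Summits.CriticalPhenomena.Ising3DConformalLimit.Theorems.EnergyNotSigmaSquaredMoebiusLimitExistsPedigreeStep
import Summits.CriticalPhenomena.Ising3DConformalLimit.Theorems.EnergyNotSigmaSquaredMoebiusLimitExistsClusterMoveIneq
import Summits.CriticalPhenomena.Ising3DConformalLimit.Theorems.EnergyNotSigmaSquaredMoebiusLimitExistsPinnedTwoPoint
import Summits.CriticalPhenomena.Ising3DConformalLimit.Theses.IsingEuclidUpgrade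
import Summits.CriticalPhenomena.Ising3DConformalLimit.Theses.MonotoneRG
import Literature.Probability.LatticeModels.CriticalUrsellFourSign
import HarnessLib

/-!
# Item 0634 ⟹ item 5955: the two-point power law gives precompactness of the critical zoom orbit
(stub T1 `stub_orbitPrecompact_of_twoPointLaw` of line `Sketch`, crux `ExistsScaleCovariantLimit`,
item stmt-CriticalPhenomena-1981, route `HyperoctahedralRP`; lead c4, 2026-08-16)

The rotation-invariant pure power law of the critical two-point function of the n.n. Ising model on `ℤ³`,
`⟨σ₀σ_x⟩_{β_c}‖x‖₂^{2Δ} → c > 0` (item stmt-0634, `IsingEuclidUpgrade.IsingEuclidUpgradeR2RotInvPowerLaw`, crux r2 of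
route `IsingEuclidUpgrade`), implies item stmt-5955 `MonotoneRG.OrbitPrecompact` — the compactness half S1 of the
existence crux `ExistsScaleCovariantLimit` (`crux_iff_orbitPrecompact_and_unique`; line `Sketch`:
`crux_iff_tight_dyadicInt_triadicInt`), so that UNDER ITEM 0634 THE EXISTENCE CRUX IS EXACTLY ITS UNIQUENESS HALF.

The content is crux 1344's (line `only-interaction-breaks-moebius`, route `EnergyNotSigmaSquared`) reflection-positivity
pedigree machinery, all LANDED and built: `pedigree_cover ∘ covering_all` (every configuration has a mirror pedigree with
positive margin), `pedigree_mono`, `pedigree_assembly` (induction on the depth) fed with the recursion step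
`pedigreeStep clusterMoveIneq_cubic` (single-variable asymptotic equicontinuity is transported across a cubic site mirror
by the CLUSTER MOVE INEQUALITY — reflection positivity of the critical state, FILS 1978 §2, and Cauchy–Schwarz for the
Gram form), `svEquicont_transport`, `doubled_thickening`, `telescoping_equicontinuity` (joint from single-variable
equicontinuity), `pinnedZoomEquicontinuous_two` (order 2 under the two-point law), `compactnessSchema` (Arzelà–Ascoli /
Cantor diagonal), `pinnedZoomLocallyBounded`, `pinnedZoomTranslationInvariant`, `stub_pinnedTwoPoint` (cluster points have
the pure-power pair function). The assembly below is that of the accepted module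
`…MoebiusLimitExistsPinnedZoomCompactnessOfStep.lean` (p110582) SPECIALISED to `hstep := pedigreeStep clusterMoveIneq_cubic`,
and the last step is that of `orbitPrecompact_of_cpt` (`…MoebiusLimitExistsResidueDictionary.lean`, p110616); both are
re-assembled here (≈ 60 lines) because the farm had not built those two modules at the time of writing (2026-08-16 17:50Z).
-- adapted from Theorems/EnergyNotSigmaSquaredMoebiusLimitExistsPinnedZoomCompactnessOfStep.lean (p110582) and
-- Theorems/EnergyNotSigmaSquaredMoebiusLimitExistsResidueDictionary.lean (p110616), line only-interaction-breaks-moebius.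

Contents: `svEquicont_all_tpl`, `equicontinuity_ge_four_tpl`, `pinnedZoom_equicontinuity_tpl`,
`pinnedZoom_compactness_of_twoPointLaw`, `orbitPrecompact_of_twoPointLawData`, `stub_orbitPrecompact_of_twoPointLaw` (T1).

References: H. Duminil-Copin, ICM 2022 §8.1, §8.4 [DuminilCopinICM2022]; J. Fröhlich, R. Israel, E. H. Lieb, B. Simon,
Comm. Math. Phys. 62 (1978) §2 [FILS1978]. No definitions, no `sorry`.
-/

noncomputable section

namespace Summit.CriticalPhenomena.Ising3DConformalLimit.Cruxes.ExistsScaleCovariantLimit.TwoHierarchies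

open Literature.Probability.LatticeModels Filter Set Function Metric
open scoped Topology
open Summit.CriticalPhenomena.Ising3DConformalLimit.MoebiusLimitExistsOnlyInteraction

/-- **Single-variable asymptotic equicontinuity of the pinned zoom at every configuration, under the two-point
law.** Along every mesh sequence `u k → 0⁺`, on every compact `K ⊆ NonCoincident 3 n` and for every index `i`:
`SVEquicont u n K i`. By locality (`svEquicont_of_locally_pa`) it suffices to treat the piece `closedBall x (μ/4) ∩ K`
around each `x ∈ K`, `μ > 0` the margin of a mirror pedigree of `x` (`pedigree_cover ∘ covering_all`); by `pedigree_mono`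
every configuration of the piece has a pedigree of the same depth with margin `μ/2`, and `pedigree_assembly` — fed with
the recursion step `pedigreeStep clusterMoveIneq_cubic` — concludes. [cite: FILS1978, §2] -/
theorem svEquicont_all_tpl {Δ c : ℝ} (hc : 0 < c)
    (hG : Tendsto (fun y : Site 3 => criticalTwoPoint 3 y * Real.sqrt (∑ i, ((y i : ℝ)) ^ 2) ^ (2 * Δ))
      cofinite (𝓝 c))
    {u : ℕ → ℝ} (hu : Tendsto u atTop (𝓝[>] (0 : ℝ))) (n : ℕ)
    (K : Set (Fin n → EuclideanSpace ℝ (Fin 3))) (hK : IsCompact K) (hKs : K ⊆ NonCoincident 3 n) (i : Fin n) :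
    SVEquicont u n K i := by
  -- adapted from …PinnedZoomCompactnessOfStep.lean `svEquicont_all_of_step` (p110582)
  refine svEquicont_of_locally_pa hK fun x hx => ?_
  obtain ⟨μ, hμ, d, hped⟩ := pedigree_cover covering_all n x (hKs hx) i
  refine ⟨μ / 4, by positivity, ?_⟩
  refine pedigree_assembly (pedigreeStep clusterMoveIneq_cubic) pedigree_mono svEquicont_transport
    doubled_thickening Δ c hc hG u hu d (μ / 2) (by positivity) n i _
    (hK.inter_left Metric.isClosed_closedBall) (fun y hy => hKs hy.2) fun y hy => ?_
  have hdist : dist x y ≤ μ / 4 := by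
    rw [dist_comm]
    exact Metric.mem_closedBall.1 hy.1
  have h := pedigree_mono μ (μ / 4) d n x y i hped hdist
  have hμ2 : μ - 2 * (μ / 4) = μ / 2 := by ring
  rwa [hμ2] at h

/-- **Joint asymptotic equicontinuity of the pinned `2m`-point zoom off the diagonals, `m ≥ 2`, under the two-point
law**: `telescoping_equicontinuity` over the single-variable moduli of `svEquicont_all_tpl`.
[cite: DuminilCopinICM2022, §8.4 p. 29] -/
theorem equicontinuity_ge_four_tpl {Δ c : ℝ} (hc : 0 < c)
    (hG : Tendsto (fun y : Site 3 => criticalTwoPoint 3 y * Real.sqrt (∑ i, ((y i : ℝ)) ^ 2) ^ (2 * Δ))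
      cofinite (𝓝 c))
    {u : ℕ → ℝ} (hu : Tendsto u atTop (𝓝[>] (0 : ℝ))) (m : ℕ)
    (K : Set (Fin (2 * m) → EuclideanSpace ℝ (Fin 3))) (hK : IsCompact K) (hKs : K ⊆ NonCoincident 3 (2 * m)) :
    ∀ ε > 0, ∃ η > 0, ∀ᶠ k in atTop, ∀ x ∈ K, ∀ y ∈ K, dist x y < η →
      |rescaledCorrelator (criticalCorr 3) rhoPin (2 * m) (u k) x -
        rescaledCorrelator (criticalCorr 3) rhoPin (2 * m) (u k) y| < ε :=
  -- adapted from …PinnedZoomCompactnessOfStep.lean `stub_equicontinuity_ge_four_of_step` (p110582)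
  telescoping_equicontinuity (2 * m)
    (fun k x => rescaledCorrelator (criticalCorr 3) rhoPin (2 * m) (u k) x) (NonCoincident 3 (2 * m))
    (isOpen_nonCoincident 3 (2 * m))
    (fun K' hK' hK's i => svEquicont_all_tpl hc hG hu (2 * m) K' hK' hK's i) K hK hKs

/-- **Asymptotic equicontinuity of the pinned zoom at ALL orders under the two-point law**: order `0` is constant
(one configuration), odd orders vanish identically (`criticalCorr_eq_zero_of_odd`), order `2` is
`pinnedZoomEquicontinuous_two`, even orders `≥ 4` are `equicontinuity_ge_four_tpl`. [folklore] -/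
theorem pinnedZoom_equicontinuity_tpl {Δ c : ℝ} (hc : 0 < c)
    (hG : Tendsto (fun y : Site 3 => criticalTwoPoint 3 y * Real.sqrt (∑ i, ((y i : ℝ)) ^ 2) ^ (2 * Δ))
      cofinite (𝓝 c))
    {u : ℕ → ℝ} (hu : Tendsto u atTop (𝓝[>] (0 : ℝ))) (n : ℕ)
    (K : Set (Fin n → EuclideanSpace ℝ (Fin 3))) (hK : IsCompact K) (hKs : K ⊆ NonCoincident 3 n) :
    ∀ ε > 0, ∃ η > 0, ∀ᶠ k in atTop, ∀ x ∈ K, ∀ y ∈ K, dist x y < η →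
      |rescaledCorrelator (criticalCorr 3) rhoPin n (u k) x -
        rescaledCorrelator (criticalCorr 3) rhoPin n (u k) y| < ε := by
  -- adapted from …PinnedZoomCompactnessOfStep.lean `pinnedZoom_equicontinuity_of_step` (p110582)
  intro ε hε
  rcases Nat.even_or_odd n with ⟨m, hm⟩ | hodd
  · obtain rfl : n = 2 * m := by omega
    rcases Nat.lt_or_ge m 2 with hm2 | _hm2
    · interval_cases m
      · -- order 0: the configuration space is a single point
        refine ⟨1, one_pos, Filter.Eventually.of_forall fun k x _ y _ _ => ?_⟩
        have hxy : x = y := funext fun i => absurd i.2 (by omega)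
        subst hxy
        simpa using hε
      · exact pinnedZoomEquicontinuous_two Δ c hc hG u hu K hK hKs ε hε
    · exact equicontinuity_ge_four_tpl hc hG hu m K hK hKs ε hε
  · -- odd orders vanish identically on the lattice
    refine ⟨1, one_pos, Filter.Eventually.of_forall fun k x _ y _ _ => ?_⟩
    rw [rescaledCorrelator_apply, rescaledCorrelator_apply, criticalCorr_eq_zero_of_odd (d := 3) le_rfl hodd,
      criticalCorr_eq_zero_of_odd (d := 3) le_rfl hodd]
    simpa using hε

/-- **Compactness of the pinned critical zoom with REGULAR cluster points under the two-point law** (crux 1344's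
STUB 1, unconditionally in its recursion step): if `⟨σ₀σ_y⟩_{β_c}‖y‖₂^{2Δ} → c > 0`, every mesh sequence `u k → 0⁺` has a
subsequence along which, for every order `n` at once, the pinned rescaled critical correlators
`ρ_pin(u k)ⁿ⟨∏σ_{[xᵢ/u k]}⟩_{β_c}` converge locally uniformly off the diagonals to a normalised, continuous-off-diagonals,
translation-invariant family (`compactnessSchema` on `pinnedZoomLocallyBounded` and `pinnedZoom_equicontinuity_tpl`, then
`pinnedZoomTranslationInvariant` along the subsequence). [cite: DuminilCopinICM2022, §8.1] -/
theorem pinnedZoom_compactness_of_twoPointLaw {Δ c : ℝ} (hc : 0 < c)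
    (hG : Tendsto (fun y : Site 3 => criticalTwoPoint 3 y * Real.sqrt (∑ i, ((y i : ℝ)) ^ 2) ^ (2 * Δ))
      cofinite (𝓝 c)) :
    ∀ u : ℕ → ℝ, Tendsto u atTop (𝓝[>] (0 : ℝ)) →
      ∃ (φ : ℕ → ℕ) (S : CorrFamily 3), StrictMono φ ∧ MoebiusLimitExistsOnlyInteraction.IsRegular S ∧
        ∀ n, TendstoLocallyUniformlyOn
          (fun k => rescaledCorrelator (criticalCorr 3) rhoPin n (u (φ k))) (S n) atTop
          (NonCoincident 3 n) := by
  -- adapted from …PinnedZoomCompactnessOfStep.lean `pinnedZoom_compactness_of_step` (p110582)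
  intro u hu
  obtain ⟨φ, S, hφ, hnorm, hcont, hconv⟩ := compactnessSchema
    (fun n k x => rescaledCorrelator (criticalCorr 3) rhoPin n (u k) x)
    (fun n K hK hKs => pinnedZoomLocallyBounded Δ c hc hG u hu n K hK hKs)
    (fun n K hK hKs => pinnedZoom_equicontinuity_tpl hc hG hu n K hK hKs)
  have hu' : Tendsto (u ∘ φ) atTop (𝓝[>] (0 : ℝ)) := hu.comp hφ.tendsto_atTop
  refine ⟨φ, S, hφ, ⟨hnorm, hcont, ?_⟩, hconv⟩
  exact pinnedZoomTranslationInvariant (u ∘ φ) hu'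
    (fun n K hK hKs => pinnedZoom_equicontinuity_tpl hc hG (u := u ∘ φ) hu' n K hK hKs) S hnorm hconv

/-- **Item 5955 `MonotoneRG.OrbitPrecompact` from the two-point law** (data form): `ρ = ρ_pin` (positive on `(0,1]`,
`rhoPin_pos`); a mesh sequence in `(0,1]` tending to `0` tends to `0⁺`, so `pinnedZoom_compactness_of_twoPointLaw`
extracts a convergent subsequence, and its limit — a cluster point of the pinned zoom (`isClusterPoint_of_subseq`) — has
the pure-power pair function `‖x₀ − x₁‖^{-2Δ}` (`stub_pinnedTwoPoint`), hence is non-degenerate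
(`isNondegenerateTwoPoint_of_twoPoint`). [cite: DuminilCopinICM2022, §8.4 p. 29] -/
theorem orbitPrecompact_of_twoPointLawData {Δ c : ℝ} (hc : 0 < c)
    (hG : Tendsto (fun y : Site 3 => criticalTwoPoint 3 y * Real.sqrt (∑ i, ((y i : ℝ)) ^ 2) ^ (2 * Δ))
      cofinite (𝓝 c)) :
    Summit.CriticalPhenomena.Ising3DConformalLimit.Theses.MonotoneRG.OrbitPrecompact := by
  -- adapted from …ResidueDictionary.lean `orbitPrecompact_of_cpt` (p110616)
  refine ⟨rhoPin, rhoPin_pos, fun u hu01 hu0 => ?_⟩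
  have hu : Tendsto u atTop (𝓝[>] (0 : ℝ)) :=
    tendsto_nhdsWithin_iff.2 ⟨hu0, Eventually.of_forall fun k => (hu01 k).1⟩
  obtain ⟨φ, S, hφ, _hreg, hconv⟩ := pinnedZoom_compactness_of_twoPointLaw hc hG u hu
  exact ⟨φ, S, hφ, isNondegenerateTwoPoint_of_twoPoint
    (stub_pinnedTwoPoint Δ c hc hG S (isClusterPoint_of_subseq hu hφ hconv)), hconv⟩

/-- **T1 (registered stub of line `Sketch`) — item stmt-CriticalPhenomena-0634 ⟹ item stmt-CriticalPhenomena-5955.**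
The rotation-invariant two-point power law `IsingEuclidUpgrade.IsingEuclidUpgradeR2RotInvPowerLaw` gives precompactness of
the critical zoom orbit with non-degenerate cluster points, `MonotoneRG.OrbitPrecompact` (= S1 of line `Sketch`; with the
line's `crux_iff_tight_dyadicInt_triadicInt`, under item 0634 the existence crux `ExistsScaleCovariantLimit` is EXACTLY
the dyadic ∧ triadic integer-configuration convergence S2' ∧ S3'). [cite: DuminilCopinICM2022, §8.4 p. 29] -/
theorem stub_orbitPrecompact_of_twoPointLaw :
    Summit.CriticalPhenomena.Ising3DConformalLimit.Theses.IsingEuclidUpgrade.IsingEuclidUpgradeR2RotInvPowerLaw →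
    Summit.CriticalPhenomena.Ising3DConformalLimit.Theses.MonotoneRG.OrbitPrecompact := by
  rintro ⟨Δ, c, hc, hG⟩
  exact orbitPrecompact_of_twoPointLawData hc hG

end Summit.CriticalPhenomena.Ising3DConformalLimit.Cruxes.ExistsScaleCovariantLimit.TwoHierarchies

end
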